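import Summits.RiemannHypothesis.RiemannHypothesis.Theorems.WeilGroundStateMarkovPartPositiveGroundStateDensityAux
import Mathlib.Analysis.Calculus.ContDiff.RCLike

/-!
# Markov part of Weil's form: window test functions are a form core (density from above)

Support file for item `MarkovPartPositiveGroundState` of route `WeilGroundState`. If a real `E`
bounds the Dirichlet energy from below on window TEST functions, `E ∫|h|² ≤ 𝓔_a(h)` for every
smooth `h` with `tsupport h ⊆ [-a, a]`, then the same bound holds on the whole finite-energy class
of the window: `E ∫|w|² ≤ 𝓔_a(w)` for every `w ∈ L²` vanishing off `[-a, a]` with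
`∫₀^∞ ρ(t) D_t(w) dt < ∞` (`bottom_mul_le_of_finiteEnergy`). Equivalently `C_c^∞` of the window is
a core of the closed jump form `𝓔_a` (Fukushima–Oshima–Takeda, Example 1.4.1). Proof, using only
the TRANSLATION INVARIANCE of `𝓔_a` (no rescaling, no continuity in the window): split
`w = βw + (1 − β)w` with a smooth Lipschitz cutoff `β` (`= 1` near the left end, `= 0` near the
right end; Lipschitz multipliers preserve finite energy, `stub_localizedCut_finiteEnergy_mul`),
shift the left piece right and the right piece left by `δ` (this frees a margin `δ` at both ends
and does not change any increment), mollify with radius `< δ` into a genuine window test function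
(increments contract, `exists_mollified_seq`), and let the radius, then `δ`, tend to `0`
(continuity of translations in `L²`, dominated convergence in the jump length).

## References

* M. Fukushima, Y. Oshima, M. Takeda, *Dirichlet Forms and Symmetric Markov Processes* (2011),
  §1.1 and Example 1.4.1.
* P. A. Feulefack, S. Jarohs, T. Weth, *Small order asymptotics of the Dirichlet eigenvalue problem
  for the fractional Laplacian*, arXiv:2010.10448, §3 (density for the logarithmic Laplacian).
-/

-- `Summit.RiemannHypothesis.RiemannHypothesis.…` repeats the summit name by design (D-0017 layout).
set_option linter.dupNamespace false

noncomputable section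

open MeasureTheory Set Filter
open scoped Topology ENNReal NNReal ArithmeticFunction.vonMangoldt

namespace Summit.RiemannHypothesis.RiemannHypothesis.Theorems.WeilGroundStateMarkovPart

open Literature.NumberTheory.LFunctions Literature.NumberTheory.LFunctions.ConnesVanSuijlekom
open Summit.RiemannHypothesis.RiemannHypothesis.Theorems.WeilWindowFlowWindowLipschitz

/-- `∫ |A + B|² ≤ 2∫|A|² + 2∫|B|²` for `A, B ∈ L²`. -/
theorem integral_norm_sq_add_le {A B : ℝ → ℂ} (hA : MemLp A 2) (hB : MemLp B 2) :
    ∫ x, ‖A x + B x‖ ^ 2 ≤ 2 * (∫ x, ‖A x‖ ^ 2) + 2 * ∫ x, ‖B x‖ ^ 2 := by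
  have hiA : Integrable fun x ↦ ‖A x‖ ^ 2 := (memLp_two_iff_integrable_sq_norm hA.1).1 hA
  have hiB : Integrable fun x ↦ ‖B x‖ ^ 2 := (memLp_two_iff_integrable_sq_norm hB.1).1 hB
  rw [← integral_const_mul, ← integral_const_mul, ← integral_add (hiA.const_mul 2) (hiB.const_mul 2)]
  refine integral_mono_of_nonneg (Eventually.of_forall fun x ↦ by positivity)
    ((hiA.const_mul 2).add (hiB.const_mul 2)) (Eventually.of_forall fun x ↦ ?_)
  have h := norm_add_le (A x) (B x)
  nlinarith [h, norm_nonneg (A x + B x), norm_nonneg (A x), norm_nonneg (B x),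
    sq_nonneg (‖A x‖ - ‖B x‖)]

/-- **One mollification step.** If `E ∫|h|² ≤ 𝓔_a(h)` for window test functions and `v ∈ L²`
vanishes off the SMALLER window `[-(a − δ), a − δ]`, `δ > 0`, with finite archimedean energy, then
`E ∫|v|² ≤ 𝓔_a(v)` (mollify `v` with radius `< δ`: a window test function with smaller increments
and almost the same norm). -/
theorem bottom_mul_le_of_margin {a E δ : ℝ} (hδ : 0 < δ)
    (hE : ∀ h : ℝ → ℂ, IsWeilTest h → tsupport h ⊆ Icc (-a) a →
      E * ∫ x, ‖h x‖ ^ 2 ≤ weilDirichletEnergy a h)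
    {v : ℝ → ℂ} (hv : MemLp v 2) (hvs : ∀ x, x ∉ Icc (-(a - δ)) (a - δ) → v x = 0)
    (hfin : IntegrableOn (fun t ↦ weilArchDensity t * weilIncrement v t) (Ioi 0)) :
    E * ∫ x, ‖v x‖ ^ 2 ≤ weilDirichletEnergy a v := by
  obtain ⟨g, hg, hgs, hD, hlim⟩ := exists_mollified_seq hv hvs
  have hgm : ∀ n, MemLp (g n) 2 := fun n ↦ (hg n).memLp_two
  obtain ⟨N, hN⟩ := exists_nat_one_div_lt hδ
  -- for `n ≥ N` the mollified function is a window test function with smaller energy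
  have hev : ∀ᶠ n in atTop, E * ∫ x, ‖g n x‖ ^ 2 ≤ weilDirichletEnergy a v := by
    refine eventually_atTop.2 ⟨N, fun n hn ↦ ?_⟩
    have hr : 1 / ((n : ℝ) + 1) ≤ δ := by
      have h1 : 1 / ((n : ℝ) + 1) ≤ 1 / ((N : ℝ) + 1) :=
        one_div_le_one_div_of_le (by positivity) (by exact_mod_cast Nat.add_le_add_right hn 1)
      linarith
    have hsupp : tsupport (g n) ⊆ Icc (-a) a :=
      (hgs n).trans (Icc_subset_Icc (by linarith) (by linarith))
    refine (hE (g n) (hg n) hsupp).trans ?_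
    unfold weilDirichletEnergy
    refine add_le_add (Finset.sum_le_sum fun k _ ↦ mul_le_mul_of_nonneg_left (hD n _)
      (div_nonneg ArithmeticFunction.vonMangoldt_nonneg (Real.sqrt_nonneg _))) ?_
    refine integral_mono_of_nonneg ?_ hfin ?_
    · exact (ae_restrict_iff' measurableSet_Ioi).2 (Eventually.of_forall fun t ht ↦
        mul_nonneg (weilArchDensity_pos ht).le (weilIncrement_nonneg _ t))
    · exact (ae_restrict_iff' measurableSet_Ioi).2 (Eventually.of_forall fun t ht ↦
        mul_le_mul_of_nonneg_left (hD n t) (weilArchDensity_pos ht).le)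
  have hN2 : Tendsto (fun n ↦ E * ∫ x, ‖g n x‖ ^ 2) atTop (𝓝 (E * ∫ x, ‖v x‖ ^ 2)) :=
    (tendsto_integral_norm_sq hv hgm hlim).const_mul E
  exact le_of_tendsto hN2 hev

/-- **A smooth Lipschitz cutoff of the window**: `β` continuous with values in `[0, 1]`,
`L`-Lipschitz, `β = 1` on `[-a, -a/4]` and `β = 0` on `[a/4, ∞)` (a `ContDiffBump` centred at
`-a`). -/
theorem exists_window_cutoff {a : ℝ} (ha : 0 < a) :
    ∃ β : ℝ → ℝ, ∃ L : ℝ, Continuous β ∧ (∀ x, 0 ≤ β x ∧ β x ≤ 1) ∧ 0 ≤ L ∧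
      (∀ x y, |β x - β y| ≤ L * |x - y|) ∧ (∀ x, -a ≤ x → x ≤ -a / 4 → β x = 1) ∧
      (∀ x, a / 4 ≤ x → β x = 0) := by
  let b : ContDiffBump (-a : ℝ) := ⟨3 * a / 4, 5 * a / 4, by positivity, by linarith⟩
  obtain ⟨C, hC⟩ := ContDiff.lipschitzWith_of_hasCompactSupport b.hasCompactSupport
    (b.contDiff (n := 1)) one_ne_zero
  refine ⟨b, C, b.continuous, fun x ↦ ⟨b.nonneg' x, b.le_one⟩, C.coe_nonneg,
    fun x y ↦ ?_, fun x hx1 hx2 ↦ ?_, fun x hx ↦ ?_⟩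
  · have := hC.dist_le_mul x y
    simpa only [Real.dist_eq] using this
  · refine b.one_of_mem_closedBall ?_
    rw [Metric.mem_closedBall, Real.dist_eq, abs_le]
    show -(3 * a / 4) ≤ x - -a ∧ x - -a ≤ 3 * a / 4
    constructor <;> linarith
  · refine b.zero_of_le_dist ?_
    rw [Real.dist_eq]
    show 5 * a / 4 ≤ |x - -a|
    rw [abs_of_nonneg (by linarith)]
    linarith

/-- **Window test functions are a form core (density from above).** Let `a > 0` and suppose
`E ∫|h|² ≤ 𝓔_a(h)` for every test function `h` with `tsupport h ⊆ [-a, a]`. Then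
`E ∫|w|² ≤ 𝓔_a(w)` for every `w ∈ L²` vanishing off `[-a, a]` whose archimedean energy density
`t ↦ ρ(t) D_t(w)` is integrable on `(0, ∞)`. See the module docstring for the proof
(cutoff–shift–mollify; Fukushima–Oshima–Takeda Example 1.4.1). -/
theorem bottom_mul_le_of_finiteEnergy {a E : ℝ} (ha : 0 < a)
    (hE : ∀ h : ℝ → ℂ, IsWeilTest h → tsupport h ⊆ Icc (-a) a →
      E * ∫ x, ‖h x‖ ^ 2 ≤ weilDirichletEnergy a h)
    {w : ℝ → ℂ} (hw : MemLp w 2) (hws : ∀ x, x ∉ Icc (-a) a → w x = 0)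
    (hfin : IntegrableOn (fun t ↦ weilArchDensity t * weilIncrement w t) (Ioi 0)) :
    E * ∫ x, ‖w x‖ ^ 2 ≤ weilDirichletEnergy a w := by
  obtain ⟨β, L, hβc, hβ01, hL, hβL, hβ1, hβ0⟩ := exists_window_cutoff ha
  -- the two pieces
  set w₁ : ℝ → ℂ := fun x ↦ (β x : ℂ) * w x with hw₁def
  set w₂ : ℝ → ℂ := fun x ↦ ((1 - β x : ℝ) : ℂ) * w x with hw₂def
  have hsum : ∀ x, w₁ x + w₂ x = w x := fun x ↦ by
    simp only [hw₁def, hw₂def]; push_cast; ring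
  have hβ01' : ∀ x, 0 ≤ 1 - β x ∧ 1 - β x ≤ 1 := fun x ↦
    ⟨by linarith [(hβ01 x).2], by linarith [(hβ01 x).1]⟩
  have hβL' : ∀ x y, |(1 - β x) - (1 - β y)| ≤ L * |x - y| := fun x y ↦ by
    rw [show (1 - β x) - (1 - β y) = β y - β x by ring, abs_sub_comm]; exact hβL x y
  have hw₁m : MemLp w₁ 2 :=
    stub_localizedCut_memLp_mul hw hβc fun x ↦ abs_le.2 ⟨by linarith [(hβ01 x).1], (hβ01 x).2⟩
  have hw₂m : MemLp w₂ 2 :=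
    stub_localizedCut_memLp_mul hw (continuous_const.sub hβc)
      fun x ↦ abs_le.2 ⟨by linarith [(hβ01' x).1], (hβ01' x).2⟩
  have hw₁e : IntegrableOn (fun t ↦ weilArchDensity t * weilIncrement w₁ t) (Ioi 0) :=
    stub_localizedCut_finiteEnergy_mul hw hβc hβ01 hL hβL hfin
  have hw₂e : IntegrableOn (fun t ↦ weilArchDensity t * weilIncrement w₂ t) (Ioi 0) :=
    stub_localizedCut_finiteEnergy_mul hw (continuous_const.sub hβc) hβ01' hL hβL' hfin
  -- supports of the pieces
  have hw₁s : ∀ x, (x < -a ∨ a / 4 ≤ x) → w₁ x = 0 := by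
    rintro x (hx | hx)
    · simp only [hw₁def, hws x fun h ↦ by linarith [h.1], mul_zero]
    · simp only [hw₁def, hβ0 x hx, Complex.ofReal_zero, zero_mul]
  have hw₂s : ∀ x, (x ≤ -a / 4 ∨ a < x) → w₂ x = 0 := by
    rintro x (hx | hx)
    · by_cases hxa : -a ≤ x
      · simp only [hw₂def, hβ1 x hxa hx, sub_self, Complex.ofReal_zero, zero_mul]
      · simp only [hw₂def, hws x fun h ↦ hxa h.1, mul_zero]
    · simp only [hw₂def, hws x fun h ↦ by linarith [h.2], mul_zero]
  have hw₁s' : ∀ x, x ∉ Icc (-a) a → w₁ x = 0 := fun x hx ↦ by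
    rcases lt_or_ge x (-a) with h | h
    · exact hw₁s x (Or.inl h)
    · exact hw₁s x (Or.inr (by
        have : ¬ x ≤ a := fun h' ↦ hx ⟨h, h'⟩
        linarith))
  have hw₂s' : ∀ x, x ∉ Icc (-a) a → w₂ x = 0 := fun x hx ↦ by
    rcases lt_or_ge x (-a) with h | h
    · exact hw₂s x (Or.inl (by linarith))
    · exact hw₂s x (Or.inr (not_le.1 fun h' ↦ hx ⟨h, h'⟩))
  -- the shifted functions
  set δ : ℕ → ℝ := fun m ↦ a / (4 * ((m : ℝ) + 1)) with hδdef
  have hδpos : ∀ m, 0 < δ m := fun m ↦ by positivity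
  have hδle : ∀ m, δ m ≤ a / 4 := fun m ↦ by
    rw [hδdef]
    exact div_le_div_of_nonneg_left ha.le (by norm_num) (by nlinarith [m.cast_nonneg (α := ℝ)])
  set v : ℕ → ℝ → ℂ := fun m x ↦ w₁ (x - δ m) + w₂ (x - (-δ m)) with hvdef
  have hvm : ∀ m, MemLp (v m) 2 := fun m ↦ (memLp_shift hw₁m _).add (memLp_shift hw₂m _)
  have hvs : ∀ m x, x ∉ Icc (-(a - δ m)) (a - δ m) → v m x = 0 := by
    intro m x hx
    have hd := hδle m
    have hd0 := hδpos m
    rcases lt_or_ge x (-(a - δ m)) with h | h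
    · simp only [hvdef]
      rw [hw₁s _ (Or.inl (by linarith)), hw₂s _ (Or.inl (by linarith)), add_zero]
    · have h' : a - δ m < x := not_le.1 fun h'' ↦ hx ⟨h, h''⟩
      simp only [hvdef]
      rw [hw₁s _ (Or.inr (by linarith)), hw₂s _ (Or.inr (by linarith)), add_zero]
  have hvD : ∀ m t, weilIncrement (v m) t ≤ 2 * weilIncrement w₁ t + 2 * weilIncrement w₂ t := by
    intro m t
    have h := weilIncrement_add_le (memLp_shift hw₁m (δ m)) (memLp_shift hw₂m (-δ m)) t
    rw [weilIncrement_shift, weilIncrement_shift] at h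
    exact h
  have hve : ∀ m, IntegrableOn (fun t ↦ weilArchDensity t * weilIncrement (v m) t) (Ioi 0) := by
    intro m
    refine Integrable.mono' ((hw₁e.const_mul 2).add (hw₂e.const_mul 2))
      (measurable_weilArchDensity.aestronglyMeasurable.mul
        (stub_localizedCut_aesm_weilIncrement (hvm m).1)).restrict ?_
    refine (ae_restrict_iff' measurableSet_Ioi).2 (Eventually.of_forall fun t (ht : 0 < t) ↦ ?_)
    rw [Real.norm_of_nonneg (mul_nonneg (weilArchDensity_pos ht).le (weilIncrement_nonneg _ t))]
    have := mul_le_mul_of_nonneg_left (hvD m t) (weilArchDensity_pos ht).le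
    simp only [Pi.add_apply]
    linarith
  -- the bound for each shifted function
  have hvE : ∀ m, E * ∫ x, ‖v m x‖ ^ 2 ≤ weilDirichletEnergy a (v m) := fun m ↦
    bottom_mul_le_of_margin (hδpos m) hE (hvm m) (hvs m) (hve m)
  -- `v m → w` in `L²`
  have hδ0 : Tendsto δ atTop (𝓝 0) := by
    have h := (tendsto_one_div_add_atTop_nhds_zero_nat (𝕜 := ℝ)).const_mul (a / 4)
    rw [mul_zero] at h
    refine h.congr fun m ↦ ?_
    simp only [hδdef]
    field_simp
  have hL2 : Tendsto (fun m ↦ ∫ x, ‖v m x - w x‖ ^ 2) atTop (𝓝 0) := by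
    have hb : ∀ m, ∫ x, ‖v m x - w x‖ ^ 2 ≤
        2 * weilIncrement w₁ (-δ m) + 2 * weilIncrement w₂ (- -δ m) := by
      intro m
      have hA : MemLp (fun x ↦ w₁ (x - δ m) - w₁ x) 2 := (memLp_shift hw₁m (δ m)).sub hw₁m
      have hB : MemLp (fun x ↦ w₂ (x - -δ m) - w₂ x) 2 := (memLp_shift hw₂m (-δ m)).sub hw₂m
      have h := integral_norm_sq_add_le hA hB
      rw [integral_norm_sq_shift_sub, integral_norm_sq_shift_sub] at h
      refine le_trans (le_of_eq (integral_congr_ae (Eventually.of_forall fun x ↦ ?_))) h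
      simp only [hvdef, ← hsum x]
      ring_nf
    have h1 : Tendsto (fun m ↦ weilIncrement w₁ (-δ m)) atTop (𝓝 0) :=
      (tendsto_weilIncrement_nhds_zero hw₁m hw₁s').comp (by simpa using hδ0.neg)
    have h2 : Tendsto (fun m ↦ weilIncrement w₂ (- -δ m)) atTop (𝓝 0) :=
      (tendsto_weilIncrement_nhds_zero hw₂m hw₂s').comp (by simpa using hδ0)
    refine squeeze_zero (fun m ↦ integral_nonneg fun _ ↦ by positivity) hb ?_
    simpa using (h1.const_mul 2).add (h2.const_mul 2)
  -- the energies converge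
  have hD : ∀ t, Tendsto (fun m ↦ weilIncrement (v m) t) atTop (𝓝 (weilIncrement w t)) :=
    tendsto_weilIncrement_of_tendsto hw hvm hL2
  have hEn : Tendsto (fun m ↦ weilDirichletEnergy a (v m)) atTop (𝓝 (weilDirichletEnergy a w)) := by
    refine Tendsto.add (tendsto_finsetSum _ fun n _ ↦ (hD (Real.log n)).const_mul _) ?_
    refine tendsto_integral_of_dominated_convergence
      (fun t ↦ 2 * (weilArchDensity t * weilIncrement w₁ t) + 2 * (weilArchDensity t * weilIncrement w₂ t))
      (fun m ↦ (measurable_weilArchDensity.aestronglyMeasurable.mul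
        (stub_localizedCut_aesm_weilIncrement (hvm m).1)).restrict)
      ((hw₁e.const_mul 2).add (hw₂e.const_mul 2)) (fun m ↦ ?_)
      (Eventually.of_forall fun t ↦ (hD t).const_mul _)
    refine (ae_restrict_iff' measurableSet_Ioi).2 (Eventually.of_forall fun t (ht : 0 < t) ↦ ?_)
    rw [Real.norm_of_nonneg (mul_nonneg (weilArchDensity_pos ht).le (weilIncrement_nonneg _ t))]
    have := mul_le_mul_of_nonneg_left (hvD m t) (weilArchDensity_pos ht).le
    linarith
  -- pass to the limit
  have hN : Tendsto (fun m ↦ E * ∫ x, ‖v m x‖ ^ 2) atTop (𝓝 (E * ∫ x, ‖w x‖ ^ 2)) :=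
    (tendsto_integral_norm_sq hw hvm hL2).const_mul E
  exact le_of_tendsto_of_tendsto' hN hEn hvE

end Summit.RiemannHypothesis.RiemannHypothesis.Theorems.WeilGroundStateMarkovPart

end
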